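import Summits.HodgeConjecture.HodgeConjecture.Theorems.K2E1SpectralTermsDiscreteHalf   -- ★ p855297 (K2E1-p09): `DiscreteClass`, `mult`, `classTrace`, `discreteSumG`
import HarnessLib

/-!
# K2·E1 — PINNING the `G`-side functional of (13.8.3) at `v` to `discreteSumG`: for a frozen off-`v` test vector (a «freezing map» `Φ : φ ↦ φ ⊗ f^v`),
# `trG(φ) := discreteSumG (Φ φ) = Σᶠ_{i ∈ cut} m_i · Tr π_i(φ ⊗ f^v) = Σᶠ_i m_i · ε_i · Tr (π_i)_v(φ)` on a finite level cut

Cell `hodgecm-mathlib`, Track B ∕ K2-LIT, squad K2, ENGINE E1 (line `K2_E1_TraceFormulaBeta`, rows 13∕18∕22); crux H413 = `stmt-HodgeConjecture-24833` (route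
`HCCMUnconditional`); seat K2E1-p09 (g0), DEAL K2E1-plan (g0) 2026-09-03T22:40:01Z.  DEFINITION (`pinnedDiscreteSum`) + PROVED bookkeeping; lane `--supports
stmt-HodgeConjecture-24833 --as helper`; no instance, no notation, no named fact, no `sorry`.  Closes no socket.  HONEST LABEL: HC_CM is proved only modulo the 7
printed citations (2 remaining named inputs: hLiu418 = `stmt-HodgeConjecture-24832`, h413 = `stmt-HodgeConjecture-24833`) until rung 0 closes; nothing here changes that count.

WHAT.  K2E1-p08's ★ `Pinned1383Letter` (p855340) reads (13.8.3) at `v` as `trTw φ = 2 Σᶠ_{i : ι} m_i · trG i φ − trH f^H` over a FINITE level cut `ι`, with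
`FlathGHyp : trG i φ = ε_i · Tr (loc i)_v(φ)`.  The `G`-side functional of print [Rogawski1990, §13.8 (13.8.3) p. 218: «`2 Σ m(π) Tr(π(f))`»] is the discrete term
(13.6.1) of `θ_G` at the test function `f = φ ⊗ f^v` FROZEN off `v` — i.e. ★ `discreteSumG` (p855297) composed with a freezing map.  No insertion-at-`v` builder for ★
`UnitaryGroup.PureTensor` exists in the tree yet (surveyed: p855087∕p855137 give `toCc`, not `update`), so — as the dealer allowed — the frozen vector enters as an
EXPLICIT map `Φ : (local test functions) → C_c(G(𝔸), ℂ)` (a parameter; for pure tensors `Φ φ = (T.update v φ).toCc` once the builder lands).  Proved here,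
DECORATION-FREE (pure bookkeeping over `tsum`∕`finsum`; no trace-class hypothesis is needed for the pinning itself):
* `pinnedDiscreteSum 𝒢 μ ν Φ φ := discreteSumG 𝒢 μ ν (Φ φ)`;
* `discreteSumG_eq_finsum_of_finite_support` — if only finitely many classes contribute, the `tsum` IS the `finsum`;
* **`discreteSumG_eq_finsum_cut`** — for a finite cut `ι` with an injective class map `cl : ι → DiscreteClass` off whose range nothing contributes (H-cut: level ∕
  Harish-Chandra finiteness, K2E1-p08's ★ p855117∕p855123 currency), `discreteSumG F = Σᶠ_i m(cl i) · Tr (cl i)(F)` — the `Σᶠ_i m_i · trG i φ` of `PinnedEq1383Hyp` with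
  `m i := (mult (cl i)).toNat`, `trG i φ := classTrace (cl i) (Φ φ)`;
* **`discreteSumG_eq_finsum_cut_flath`** — with the per-class Flath factorisation `Tr (cl i)(Φ φ) = ε_i · t_i` (row 18, hypothesis BY SHAPE: `t_i = Tr (loc i)_v(φ)`),
  `discreteSumG (Φ φ) = Σᶠ_i m_i · ε_i · t_i`; `pinnedDiscreteSum_eq_finsum_smoothTrace` — the same for `U(Φ₃)` with `t_i := (loc i v).smoothTrace νQv φ` LITERALLY, the
  summand shape of ★ `FlathGHyp` ∕ `E1St1383Letter`.

References: [Rogawski1990] §13.8 display (13.8.3) p. 218, p. 219 line 1; §13.6 (13.6.1) p. 208.  [FlathCorvallis1979] Thm. 3.  [BorelJacquet1979] §4.6.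
-/

set_option autoImplicit false
-- the mandated namespace has the single-problem summit's repeated segment (`HodgeConjecture.HodgeConjecture`)
set_option linter.dupNamespace false

noncomputable section

namespace Summit.HodgeConjecture.HodgeConjecture.Cruxes.H413.K2E1PinnedGFunctionalOfDiscreteSum

open MeasureTheory NumberField CompactlySupported
open Literature.NumberTheory.Automorphic
open Summit.HodgeConjecture.HodgeConjecture.Cruxes.H413.K2E1SpectralTermsDiscreteHalf

universe u

section Generic

variable {K : Type} [Field K] [NumberField K] (𝒢 : AdelicGroupData.{u} K) (μ : Measure 𝒢.automorphicQuotient) [𝒢.IsAutomorphicMeasure μ]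
  [MeasurableSpace 𝒢.Adelic] [BorelSpace 𝒢.Adelic] (ν : Measure 𝒢.Adelic) [IsFiniteMeasureOnCompacts ν]

/-- **The pinned `G`-side functional**: `φ ↦ Σ'_π m(π) Tr π(Φ φ)` — the discrete term (13.6.1) of `θ_G` (★ `discreteSumG`) at the global test function `Φ φ = φ ⊗ f^v`
obtained by FREEZING the off-`v` vector (`Φ` = the freezing map, a parameter). [cite: Rogawski1990, §13.8 display (13.8.3) p. 218] [cite: Rogawski1990, §13.6 (13.6.1) p. 208] -/
def pinnedDiscreteSum {X : Type*} (Φ : X → C_c(𝒢.Adelic, ℂ)) (φ : X) : ℂ :=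
  discreteSumG 𝒢 μ ν (Φ φ)

variable {𝒢 μ}

/-- **Finitely many contributing classes ⇒ `Σ' = Σᶠ`** (Mathlib `tsum_eq_finsum`). [cite: Rogawski1990, §13.8 p. 219] -/
theorem discreteSumG_eq_finsum_of_finite_support (F : C_c(𝒢.Adelic, ℂ))
    (h : (Function.support fun c : DiscreteClass 𝒢 μ => ((c.mult).toNat : ℂ) * c.classTrace ν F).Finite) :
    discreteSumG 𝒢 μ ν F = ∑ᶠ c : DiscreteClass 𝒢 μ, ((c.mult).toNat : ℂ) * c.classTrace ν F :=
  tsum_eq_finsum h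

/-- **PINNING TO A FINITE CUT.**  Let `ι` be a finite cut with an INJECTIVE class map `cl : ι → DiscreteClass 𝒢 μ` (the classes of the contributing `π`: unramified off
`v` below the frozen level, archimedean component in the pinned packets — K2E1-p08's `HCFinitenessU3` currency) such that NO class off its range contributes
(`m(c) · Tr c(F) = 0`, e.g. `Tr c(F) = 0` for lack of fixed vectors).  Then `Σ'_π m(π) Tr π(F) = Σᶠ_{i : ι} m(cl i) · Tr (cl i)(F)` — the `Σᶠ_i m_i · trG i φ` of ★
`PinnedEq1383Hyp` with `m i := (mult (cl i)).toNat`, `trG i φ := classTrace (cl i) (Φ φ)`. [cite: Rogawski1990, §13.8 display (13.8.3) p. 218 and p. 219 line 1]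
[cite: BorelJacquet1979, §4.6] -/
theorem discreteSumG_eq_finsum_cut (F : C_c(𝒢.Adelic, ℂ)) {ι : Type*} [Finite ι] (cl : ι → DiscreteClass 𝒢 μ) (hcl : Function.Injective cl)
    (hoff : ∀ c : DiscreteClass 𝒢 μ, c ∉ Set.range cl → ((c.mult).toNat : ℂ) * c.classTrace ν F = 0) :
    discreteSumG 𝒢 μ ν F = ∑ᶠ i : ι, (((cl i).mult).toNat : ℂ) * (cl i).classTrace ν F := by
  classical
  haveI : Fintype ι := Fintype.ofFinite ι
  set g : DiscreteClass 𝒢 μ → ℂ := fun c => ((c.mult).toNat : ℂ) * c.classTrace ν F with hg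
  have hsupp : Function.support g ⊆ ((Finset.univ : Finset ι).image cl : Set (DiscreteClass 𝒢 μ)) := by
    intro c hc
    by_contra hc'
    apply hc
    apply hoff c
    rintro ⟨i, rfl⟩
    exact hc' (by simp)
  have hfin : (Function.support g).Finite := (Finset.finite_toSet _).subset hsupp
  rw [discreteSumG_eq_finsum_of_finite_support ν F hfin, finsum_eq_sum_of_support_subset g hsupp, Finset.sum_image fun i _ j _ h => hcl h,
    finsum_eq_sum_of_fintype]

/-- **PINNING + FLATH (row 18 by shape).**  With the data of `discreteSumG_eq_finsum_cut` and the per-class factorisation `Tr (cl i)(F) = ε_i · t_i` (★ `FlathGHyp` shape: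
`t_i = Tr (loc i)_v(φ)`, `ε_i` the archimedean sign times the unit factors), `Σ'_π m(π) Tr π(F) = Σᶠ_i m_i · (ε_i · t_i)`.
[cite: Rogawski1990, §13.8 p. 219 line 1] [cite: FlathCorvallis1979, Thm. 3] -/
theorem discreteSumG_eq_finsum_cut_flath (F : C_c(𝒢.Adelic, ℂ)) {ι : Type*} [Finite ι] (cl : ι → DiscreteClass 𝒢 μ) (hcl : Function.Injective cl)
    (hoff : ∀ c : DiscreteClass 𝒢 μ, c ∉ Set.range cl → ((c.mult).toNat : ℂ) * c.classTrace ν F = 0)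
    (ε : ι → ℤ) (t : ι → ℂ) (hFl : ∀ i, (cl i).classTrace ν F = (ε i : ℂ) * t i) :
    discreteSumG 𝒢 μ ν F = ∑ᶠ i : ι, (((cl i).mult).toNat : ℂ) * ((ε i : ℂ) * t i) := by
  rw [discreteSumG_eq_finsum_cut ν F cl hcl hoff]
  exact finsum_congr fun i => by rw [hFl i]

/-- The pinned functional on a frozen vector, cut + Flath form: `pinnedDiscreteSum Φ φ = Σᶠ_i m_i · (ε_i · t_i)`. [cite: Rogawski1990, §13.8 display (13.8.3) p. 218] -/
theorem pinnedDiscreteSum_eq_finsum {X : Type*} (Φ : X → C_c(𝒢.Adelic, ℂ)) (φ : X) {ι : Type*} [Finite ι] (cl : ι → DiscreteClass 𝒢 μ)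
    (hcl : Function.Injective cl) (hoff : ∀ c : DiscreteClass 𝒢 μ, c ∉ Set.range cl → ((c.mult).toNat : ℂ) * c.classTrace ν (Φ φ) = 0)
    (ε : ι → ℤ) (t : ι → ℂ) (hFl : ∀ i, (cl i).classTrace ν (Φ φ) = (ε i : ℂ) * t i) :
    pinnedDiscreteSum 𝒢 μ ν Φ φ = ∑ᶠ i : ι, (((cl i).mult).toNat : ℂ) * ((ε i : ℂ) * t i) :=
  discreteSumG_eq_finsum_cut_flath ν (Φ φ) cl hcl hoff ε t hFl

end Generic

/-! ## The quasi-split `U(3)` at a finite place `v`: the summand shape of ★ `FlathGHyp` ∕ `E1St1383Letter` literally -/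

section QuasiSplitU3

open Literature.NumberTheory.Rogawski1990 Literature.NumberTheory.Automorphic.UnitaryGroup
open IsDedekindDomain

variable (L : Type) [Field L] [NumberField L] [IsCMField L]
  (μG : Measure (UnitaryGroup.cmDatum L 3 (qsForm L)).automorphicQuotient) [(UnitaryGroup.cmDatum L 3 (qsForm L)).IsAutomorphicMeasure μG]
  [MeasurableSpace (UnitaryGroup.cmDatum L 3 (qsForm L)).Adelic] [BorelSpace (UnitaryGroup.cmDatum L 3 (qsForm L)).Adelic]
  (νG : Measure (UnitaryGroup.cmDatum L 3 (qsForm L)).Adelic) [IsFiniteMeasureOnCompacts νG]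
  (v : HeightOneSpectrum (𝓞 ↥(maximalRealSubfield L))) [MeasurableSpace (Gqs L v)] (νQv : Measure (Gqs L v))

/-- **`trG` PINNED, for `U(Φ₃)` at `v`**: with a freezing map `Φ : (Gqs L v → ℂ) → C_c(U(Φ₃)(𝔸), ℂ)` (the frozen off-`v` unit ∕ pseudo-coefficient vector), a finite cut
`ι` of families `loc i` with injective class map `cl` (classes of the occurring `π_i`), no contribution off the cut, and the Flath factorisation
`Tr (cl i)(Φ φ) = ε_i · Tr (loc i)_v(φ)` (★ `FlathGHyp` shape), the discrete term of `θ_G` at `Φ φ` is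
`Σᶠ_i m_i · (ε_i · (loc i v).smoothTrace νQv φ)` — token shape of the `G`-side of (13.8.3) at `v` [p. 219 line 1: «`2 Σ m(π) ε_π Tr(π^∞(f^∞))`»].
[cite: Rogawski1990, §13.8 display (13.8.3) p. 218 and p. 219 line 1] [cite: FlathCorvallis1979, Thm. 3] -/
theorem pinnedDiscreteSum_eq_finsum_smoothTrace (Φ : (Gqs L v → ℂ) → C_c((UnitaryGroup.cmDatum L 3 (qsForm L)).Adelic, ℂ)) (φ : Gqs L v → ℂ)
    {ι : Type} [Finite ι] (loc : ι → ∀ u : HeightOneSpectrum (𝓞 ↥(maximalRealSubfield L)), IrrClass (Gqs L u)) (cl : ι → DiscreteClass (UnitaryGroup.cmDatum L 3 (qsForm L)) μG)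
    (hcl : Function.Injective cl)
    (hoff : ∀ c : DiscreteClass (UnitaryGroup.cmDatum L 3 (qsForm L)) μG, c ∉ Set.range cl → ((c.mult).toNat : ℂ) * c.classTrace νG (Φ φ) = 0)
    (ε : ι → ℤ) (hFl : ∀ i, (cl i).classTrace νG (Φ φ) = (ε i : ℂ) * (loc i v).smoothTrace νQv φ) :
    pinnedDiscreteSum (UnitaryGroup.cmDatum L 3 (qsForm L)) μG νG Φ φ =
      ∑ᶠ i : ι, (((cl i).mult).toNat : ℂ) * ((ε i : ℂ) * (loc i v).smoothTrace νQv φ) :=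
  pinnedDiscreteSum_eq_finsum νG Φ φ cl hcl hoff ε (fun i => (loc i v).smoothTrace νQv φ) hFl

end QuasiSplitU3

end Summit.HodgeConjecture.HodgeConjecture.Cruxes.H413.K2E1PinnedGFunctionalOfDiscreteSum

end
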